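import Summits.AtomisticToContinuum.BoseEinsteinCondensation.Theses.BECDressedKac

/-!
# AtomisticToContinuum / BoseEinsteinCondensation — route `BECDressedKac`, `WindowArithmetic`

Settles the support item `stmt-AtomisticToContinuum-14633` of route
`route-AtomisticToContinuum-BECDressedKac`:
`WindowArithmetic := SplittingConstruction → DressedKacCondensation → PeriodicBEC`,
i.e. the Kac window of `DressedKacCondensation` is non-empty for every repulsive finite-range
potential at every sufficiently small density.

Proof (real-parameter bookkeeping only). `DressedKacCondensation` gives universal thresholds
`M, η, ε₀ > 0`; `SplittingConstruction` gives, for the potential `v`, constants `A ≥ 0`, `R₁ > 0`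
and, at every radius `R ≥ R₁`, a splitting `(w, f)` with `w ≤ A/R³`, `∫w ≤ A`,
`∫(1 - f²) ≤ A R²`. Put `B := A + 1`, `R⋆ := max (R₁, B/η, M B/η, M B/ε₀)` and `ρ₀ := M / R⋆³`.
For `0 < ρ < ρ₀` take `R := (M/ρ)^{1/3}`, so that `ρ R³ = M` and `R ≥ R⋆ ≥ R₁`; then
`w ≤ A/R³ ≤ η/R²` (as `η R ≥ B > A`), `ρ R² ∫w ≤ ρ R² A = M A / R ≤ η` (as `η R ≥ M B ≥ M A`) and
`ρ ∫(1 - f²) ≤ ρ A R² = M A / R ≤ ε₀` (as `ε₀ R ≥ M B ≥ M A`), so `DressedKacCondensation`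
applies at `(v, w, f, R, ρ)` and yields exactly the body of `PeriodicBEC`.
-/

namespace Summit.AtomisticToContinuum.BoseEinsteinCondensation.Theorems

open Summit.AtomisticToContinuum.BoseEinsteinCondensation.Theses.BECDressedKac

/-- Cube roots via `Real.rpow`: for `0 ≤ x`, `(x ^ (1/3)) ^ 3 = x` (with the exponent spelled
`((3 : ℕ) : ℝ)⁻¹`). [folklore] -/
private lemma rpow_inv_three_pow_three {x : ℝ} (hx : 0 ≤ x) :
    (x ^ (((3 : ℕ) : ℝ)⁻¹)) ^ 3 = x :=
  Real.rpow_inv_natCast_pow hx (by norm_num)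

/-- The window arithmetic behind `WindowArithmetic`: given thresholds `M, η, ε₀ > 0` and splitting
constants `A` (any real), `R₁ > 0`, there is `ρ₀ > 0` such that every density `0 < ρ < ρ₀` admits
a radius `R ≥ R₁` with `ρ R³ = M`, `A/R³ ≤ η/R²`, `ρ R² A ≤ η` and `ρ (A R²) ≤ ε₀`
(`ρ₀ := M/R⋆³`, `R⋆ := max (R₁, B/η, M B/η, M B/ε₀)`, `B := A + 1`, `R := (M/ρ)^{1/3}`).
[folklore] -/
theorem windowArithmetic_radius {M η ε₀ R₁ : ℝ} (A : ℝ) (hM : 0 < M) (hη : 0 < η)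
    (hε₀ : 0 < ε₀) (hR₁ : 0 < R₁) :
    ∃ ρ₀ : ℝ, 0 < ρ₀ ∧ ∀ ρ : ℝ, 0 < ρ → ρ < ρ₀ →
      ∃ R : ℝ, R₁ ≤ R ∧ 0 < R ∧ ρ * R ^ 3 = M ∧ A / R ^ 3 ≤ η / R ^ 2 ∧
        ρ * R ^ 2 * A ≤ η ∧ ρ * (A * R ^ 2) ≤ ε₀ := by
  set B : ℝ := A + 1 with hB
  have hAB : A < B := by rw [hB]; linarith
  -- the threshold radius
  set Rs : ℝ := max (max (max R₁ (B / η)) (M * B / η)) (M * B / ε₀) with hRs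
  have hRs₁ : R₁ ≤ Rs := le_trans (le_trans (le_max_left _ _) (le_max_left _ _)) (le_max_left _ _)
  have hRs₂ : B / η ≤ Rs := le_trans (le_trans (le_max_right _ _) (le_max_left _ _)) (le_max_left _ _)
  have hRs₃ : M * B / η ≤ Rs := le_trans (le_max_right _ _) (le_max_left _ _)
  have hRs₄ : M * B / ε₀ ≤ Rs := le_max_right _ _
  have hRspos : 0 < Rs := lt_of_lt_of_le hR₁ hRs₁
  refine ⟨M / Rs ^ 3, div_pos hM (pow_pos hRspos 3), fun ρ hρ hρlt => ?_⟩
  -- the radius `R := (M/ρ)^{1/3}`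
  have hMρ : 0 < M / ρ := div_pos hM hρ
  set R : ℝ := (M / ρ) ^ (((3 : ℕ) : ℝ)⁻¹) with hR
  have hRpos : 0 < R := Real.rpow_pos_of_pos hMρ _
  have hR3 : R ^ 3 = M / ρ := rpow_inv_three_pow_three hMρ.le
  have hρR3 : ρ * R ^ 3 = M := by
    rw [hR3]; field_simp
  -- `R ≥ R⋆`: from `ρ < M / R⋆³` we get `R⋆³ < M/ρ = R³`.
  have hRsR : Rs ≤ R := by
    have h1 : Rs ^ 3 < R ^ 3 := by
      rw [hR3, lt_div_iff₀ hρ]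
      have := (lt_div_iff₀ (pow_pos hRspos 3)).1 hρlt
      linarith [this]
    exact le_of_lt (lt_of_pow_lt_pow_left₀ 3 hRpos.le h1)
  have hR₁R : R₁ ≤ R := le_trans hRs₁ hRsR
  -- the three consequences of `R ≥ R⋆`
  have hηR : B ≤ η * R := by
    have h := (div_le_iff₀ hη).1 (le_trans hRs₂ hRsR)
    linarith [h]
  have hMBη : M * B ≤ η * R := by
    have h := (div_le_iff₀ hη).1 (le_trans hRs₃ hRsR)
    linarith [h]
  have hMBε : M * B ≤ ε₀ * R := by
    have h := (div_le_iff₀ hε₀).1 (le_trans hRs₄ hRsR)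
    linarith [h]
  have hMA_MB : M * A ≤ M * B := mul_le_mul_of_nonneg_left hAB.le hM.le
  refine ⟨R, hR₁R, hRpos, hρR3, ?_, ?_, ?_⟩
  · -- `A / R³ ≤ η / R²`
    rw [div_le_div_iff₀ (pow_pos hRpos 3) (pow_pos hRpos 2)]
    have hAηR : A ≤ η * R := le_trans hAB.le hηR
    have hR2 : 0 ≤ R ^ 2 := (pow_pos hRpos 2).le
    calc A * R ^ 2 ≤ η * R * R ^ 2 := mul_le_mul_of_nonneg_right hAηR hR2
      _ = η * R ^ 3 := by ring
  · -- `ρ R² A ≤ η`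
    have key : ρ * R ^ 2 * A * R = M * A := by
      calc ρ * R ^ 2 * A * R = ρ * R ^ 3 * A := by ring
        _ = M * A := by rw [hρR3]
    have h2 : ρ * R ^ 2 * A * R ≤ η * R := by
      rw [key]; exact le_trans hMA_MB hMBη
    exact le_of_mul_le_mul_right h2 hRpos
  · -- `ρ (A R²) ≤ ε₀`
    have key : ρ * (A * R ^ 2) * R = M * A := by
      calc ρ * (A * R ^ 2) * R = ρ * R ^ 3 * A := by ring
        _ = M * A := by rw [hρR3]
    have h2 : ρ * (A * R ^ 2) * R ≤ ε₀ * R := by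
      rw [key]; exact le_trans hMA_MB hMBε
    exact le_of_mul_le_mul_right h2 hRpos

/-- Settles `stmt-AtomisticToContinuum-14633` (exact signature): the support `WindowArithmetic`
of route `BECDressedKac`, `SplittingConstruction → DressedKacCondensation → PeriodicBEC` — the
Kac window `ρR³ ≥ M`, `w ≤ η/R²`, `ρR²∫w ≤ η`, `ρ∫(1-f²) ≤ ε₀` is met by the exact splitting at
radius `R = (M/ρ)^{1/3}` for every `ρ < ρ₀(v) := M/R⋆³`, `R⋆ := max (R₁, B/η, MB/η, MB/ε₀)`,
`B := A + 1`. [folklore] -/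
theorem windowArithmetic_proof :
    Summit.AtomisticToContinuum.BoseEinsteinCondensation.Theses.BECDressedKac.WindowArithmetic := by
  unfold Theses.BECDressedKac.WindowArithmetic
  intro hS hD v hv
  obtain ⟨M, η, ε₀, hM, hη, hε₀, hDK⟩ := hD
  obtain ⟨A, R₁, -, hR₁, hSR⟩ := hS v hv
  obtain ⟨ρ₀, hρ₀, hwin⟩ := windowArithmetic_radius A hM hη hε₀ hR₁
  refine ⟨ρ₀, hρ₀, fun ρ hρ hρlt => ?_⟩
  obtain ⟨R, hR₁R, hRpos, hρR3, hBorn, hHeal, hMayer⟩ := hwin ρ hρ hρlt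
  obtain ⟨w, f, hw_meas, hv_range, hw_range, hw_le, hw_int, hw_pos, hf_bounds, hf_one, hf_lip,
    hf_defect, hsplit_val, hsplit_min⟩ := hSR R hR₁R
  refine hDK v w f R ρ hv.1 hw_meas hRpos hρ hv_range hw_range ?_ hw_pos hf_bounds hf_one hf_lip
    hsplit_val hsplit_min hρR3.symm.le ?_ ?_
  · -- Born: `w ≤ A/R³ ≤ η/R²`
    intro s
    exact (hw_le s).trans (ENNReal.ofReal_le_ofReal hBorn)
  · -- sub-healing: `ρ R² ∫w ≤ ρ R² A ≤ η`
    have hρR2 : 0 ≤ ρ * R ^ 2 := by positivity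
    calc ENNReal.ofReal (ρ * R ^ 2) * (∫⁻ x : Literature.MathematicalPhysics.QuantumManyBody.BoseGas.Space, w ‖x‖)
        ≤ ENNReal.ofReal (ρ * R ^ 2) * ENNReal.ofReal A := mul_le_mul_right hw_int _
      _ = ENNReal.ofReal (ρ * R ^ 2 * A) := (ENNReal.ofReal_mul hρR2).symm
      _ ≤ ENNReal.ofReal η := ENNReal.ofReal_le_ofReal hHeal
  · -- Mayer: `ρ ∫(1 - f²) ≤ ρ A R² ≤ ε₀`
    calc ENNReal.ofReal ρ * (∫⁻ x : Literature.MathematicalPhysics.QuantumManyBody.BoseGas.Space, ENNReal.ofReal (1 - f ‖x‖ ^ 2))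
        ≤ ENNReal.ofReal ρ * ENNReal.ofReal (A * R ^ 2) := mul_le_mul_right hf_defect _
      _ = ENNReal.ofReal (ρ * (A * R ^ 2)) := (ENNReal.ofReal_mul hρ.le).symm
      _ ≤ ENNReal.ofReal ε₀ := ENNReal.ofReal_le_ofReal hMayer

end Summit.AtomisticToContinuum.BoseEinsteinCondensation.Theorems
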